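import Mathlib
import HarnessLib
import Summits.AtomisticToContinuum.Crystallization.Theorems.PricedLinkCensusSoftFourRingsThreeTriQuad

/-!
# The sharp lower corner bound of a soft link star

Route `PricedLinkCensus`, item `SoftFourRings` (stmt-AtomisticToContinuum-14234), evidence
`softrings-search.md` §10 (C2): the companion of `corner_cos_lower`
(`PricedLinkCensusSoftFourRingsThreeTriQuad`).  Two link-neighbours `w, w'` of a site `v`
(`cb ≤ ⟪v, w⟫, ⟪v, w'⟫ ≤ ca`) that are merely separated (`⟪w, w'⟫ ≤ ca`) subtend at `v` a tangent angle
of cosine `≤ K' = (ca − cb²)/(1 − cb²)` — the isosceles spherical triangle with the two LONGEST legs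
`arccos cb` and the SHORTEST base `arccos ca` (`69.204°` at `η = 1/100`, against the crude
`arccos ((ca − cb²)/(1 − ca²)) = 68.62°` used in `no_bonded_four_cycle`).  Together with
`corner_cos_lower` this pins every triangle corner of the soft link into `[69.204°, 71.893°]` and every
ring corner of a three-triangle fan into `[144.32°, 152.39°]`, the input of the antiprism exclusion (C).
-/

namespace Summit.AtomisticToContinuum.Crystallization.Theorems

open Real RealInnerProductSpace

/-- **The sharp separation bound at a link star.**  Let `0 < cb ≤ ca < 1`,
`K' (1 − cb²) = ca − cb²` and `K'² ca² (1 − cb²) ≤ cb² (1 − ca²)`.  If `p = cos φ`, `q = cos ψ` both lie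
in `[cb, ca]`, `s = sin φ, t = sin ψ ≥ 0`, and the spherical law of cosines gives a separated pair,
`p q + s t c ≤ ca` with `c` the cosine of the angle at the pole, then `c ≤ K'`: two link-neighbours
of a site subtend at it an angle `≥ arccos K'`, with equality for legs `arccos cb` and base
`arccos ca`.  (Monotonicity: `p q + K' s t` decreases as `p`, then `q`, decrease to `cb`, where it
equals `ca`.) [folklore] -/
theorem corner_cos_upper {ca cb K' p q s t c : ℝ} (hcb0 : 0 < cb) (hcba : cb ≤ ca) (hca1 : ca < 1)
    (hK' : K' * (1 - cb ^ 2) = ca - cb ^ 2)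
    (hKs : K' ^ 2 * ca ^ 2 * (1 - cb ^ 2) ≤ cb ^ 2 * (1 - ca ^ 2))
    (hp : cb ≤ p) (hp' : p ≤ ca) (hq : cb ≤ q) (hq' : q ≤ ca) (hs0 : 0 ≤ s)
    (hs : s ^ 2 = 1 - p ^ 2) (ht0 : 0 ≤ t) (ht : t ^ 2 = 1 - q ^ 2)
    (hsepc : p * q + s * t * c ≤ ca) : c ≤ K' := by
  have hca0 : 0 < ca := hcb0.trans_le hcba
  have hq0 : 0 < q := hcb0.trans_le hq
  have h1ca : 0 < 1 - ca ^ 2 := by nlinarith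
  have h1cb : 0 < 1 - cb ^ 2 := by nlinarith
  have hK0 : 0 < K' := by
    by_contra h
    have h' : K' ≤ 0 := not_lt.mp h
    have := mul_le_mul_of_nonneg_right h' h1cb.le
    rw [hK', zero_mul] at this
    nlinarith
  obtain ⟨sa, hsa0, hsa2⟩ : ∃ sa : ℝ, 0 < sa ∧ sa ^ 2 = 1 - ca ^ 2 :=
    ⟨Real.sqrt (1 - ca ^ 2), Real.sqrt_pos.2 h1ca, Real.sq_sqrt h1ca.le⟩
  obtain ⟨sb, hsb0, hsb2⟩ : ∃ sb : ℝ, 0 < sb ∧ sb ^ 2 = 1 - cb ^ 2 :=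
    ⟨Real.sqrt (1 - cb ^ 2), Real.sqrt_pos.2 h1cb, Real.sq_sqrt h1cb.le⟩
  have hca : ca = cb ^ 2 + K' * sb ^ 2 := by rw [hsb2]; linarith
  -- `sa ≤ s`, `sa ≤ t`, `sa ≤ sb`
  have hsa_s : sa ≤ s := by
    have : sa ^ 2 ≤ s ^ 2 := by
      rw [hsa2, hs]; nlinarith [mul_le_mul hp' hp' (hcb0.le.trans hp) hca0.le]
    exact (pow_le_pow_iff_left₀ hsa0.le hs0 two_ne_zero).1 this
  have hsa_t : sa ≤ t := by
    have : sa ^ 2 ≤ t ^ 2 := by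
      rw [hsa2, ht]; nlinarith [mul_le_mul hq' hq' hq0.le hca0.le]
    exact (pow_le_pow_iff_left₀ hsa0.le ht0 two_ne_zero).1 this
  have hsa_sb : sa ≤ sb := by
    have : sa ^ 2 ≤ sb ^ 2 := by
      rw [hsa2, hsb2]; nlinarith [mul_le_mul hcba hcba hcb0.le hca0.le]
    exact (pow_le_pow_iff_left₀ hsa0.le hsb0.le two_ne_zero).1 this
  -- `K' sb ca ≤ cb sa` and `K' t ca ≤ q sa`, from the side condition on the constants
  have hK1 : K' * sb * ca ≤ cb * sa := by
    have h1 : (K' * sb * ca) ^ 2 ≤ (cb * sa) ^ 2 := by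
      rw [mul_pow, mul_pow, mul_pow, hsb2, hsa2]; linarith
    exact (pow_le_pow_iff_left₀ (by positivity) (by positivity) two_ne_zero).1 h1
  have hK2 : K' * t * ca ≤ q * sa := by
    have hq2 : cb ^ 2 ≤ q ^ 2 := by nlinarith
    have h1 : (K' * t * ca) ^ 2 ≤ (q * sa) ^ 2 := by
      rw [mul_pow, mul_pow, mul_pow, ht, hsa2]
      have hA : K' ^ 2 * (1 - q ^ 2) * ca ^ 2 ≤ K' ^ 2 * ca ^ 2 * (1 - cb ^ 2) := by
        have := mul_le_mul_of_nonneg_left hq2 (mul_nonneg (sq_nonneg K') (sq_nonneg ca))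
        linarith
      have hB : cb ^ 2 * (1 - ca ^ 2) ≤ q ^ 2 * (1 - ca ^ 2) :=
        mul_le_mul_of_nonneg_right hq2 h1ca.le
      linarith
    exact (pow_le_pow_iff_left₀ (by positivity) (by positivity) two_ne_zero).1 h1
  -- step A: decreasing `p` to `cb` decreases `p q + K' s t`, i.e. `K' t (sb - s) ≤ q (p - cb)`
  have stepA : cb * q + K' * sb * t ≤ p * q + K' * s * t := by
    have e1 : (sb - s) * (sb + s) = (p - cb) * (p + cb) := by linear_combination hsb2 - hs
    have hpos : 0 < sb + s := by linarith
    have hpc : 0 ≤ p - cb := by linarith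
    have key : K' * t * (sb - s) * (sb + s) ≤ q * (p - cb) * (sb + s) :=
      calc K' * t * (sb - s) * (sb + s) = K' * t * ((p - cb) * (p + cb)) := by
            rw [mul_assoc, e1]
        _ ≤ K' * t * ((p - cb) * (2 * ca)) := by
            apply mul_le_mul_of_nonneg_left _ (mul_nonneg hK0.le ht0)
            exact mul_le_mul_of_nonneg_left (by linarith) hpc
        _ = 2 * (p - cb) * (K' * t * ca) := by ring
        _ ≤ 2 * (p - cb) * (q * sa) := mul_le_mul_of_nonneg_left hK2 (by linarith)
        _ ≤ q * (p - cb) * (sb + s) := by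
            linarith [mul_nonneg (mul_nonneg hq0.le hpc) (by linarith : (0 : ℝ) ≤ sb + s - 2 * sa)]
    have := le_of_mul_le_mul_right key hpos
    linarith [this]
  -- step B: then decreasing `q` to `cb`: `K' sb (sb - t) ≤ cb (q - cb)`
  have stepB : cb ^ 2 + K' * sb ^ 2 ≤ cb * q + K' * sb * t := by
    have e1 : (sb - t) * (sb + t) = (q - cb) * (q + cb) := by linear_combination hsb2 - ht
    have hpos : 0 < sb + t := by linarith
    have hqc : 0 ≤ q - cb := by linarith
    have key : K' * sb * (sb - t) * (sb + t) ≤ cb * (q - cb) * (sb + t) :=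
      calc K' * sb * (sb - t) * (sb + t) = K' * sb * ((q - cb) * (q + cb)) := by
            rw [mul_assoc, e1]
        _ ≤ K' * sb * ((q - cb) * (2 * ca)) := by
            apply mul_le_mul_of_nonneg_left _ (mul_nonneg hK0.le hsb0.le)
            exact mul_le_mul_of_nonneg_left (by linarith) hqc
        _ = 2 * (q - cb) * (K' * sb * ca) := by ring
        _ ≤ 2 * (q - cb) * (cb * sa) := mul_le_mul_of_nonneg_left hK1 (by linarith)
        _ ≤ cb * (q - cb) * (sb + t) := by
            linarith [mul_nonneg (mul_nonneg hcb0.le hqc) (by linarith : (0 : ℝ) ≤ sb + t - 2 * sa)]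
    have := le_of_mul_le_mul_right key hpos
    nlinarith [this]
  -- conclusion
  by_contra hc
  have hc' : K' < c := not_le.mp hc
  rcases (mul_nonneg hs0 ht0).eq_or_lt with h0 | hpos
  · -- `s t = 0` forces `p = 1` or `q = 1`, impossible
    rcases mul_eq_zero.1 h0.symm with h | h
    · rw [h, zero_pow two_ne_zero] at hs
      have h1 := mul_lt_mul_of_pos_left (hp'.trans_lt hca1) (hcb0.trans_le hp)
      have h2 : p ^ 2 = 1 := by linarith
      rw [sq] at h2
      linarith
    · rw [h, zero_pow two_ne_zero] at ht
      have h1 := mul_lt_mul_of_pos_left (hq'.trans_lt hca1) hq0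
      have h2 : q ^ 2 = 1 := by linarith
      rw [sq] at h2
      linarith
  · have : s * t * K' < s * t * c := mul_lt_mul_of_pos_left hc' hpos
    linarith [stepA, stepB]

/-- **The `η = 1/100` instance**: with `ca = 1 − 1/(2·(101/100)²) = 5201/10201`,
`cb = 1 − (101/100)²/2 = 9799/20000`, two link-neighbours of a site subtend at it a tangent angle of
cosine `≤ K' = (ca − cb²)/(1 − cb²) = 1100895889399/3100895889399 = 0.35502` (`≥ 69.204°`).
[folklore] -/
theorem corner_cos_upper_one_percent {p q s t c : ℝ}
    (hp : 1 - (101 / 100 : ℝ) ^ 2 / 2 ≤ p) (hp' : p ≤ 1 - 1 / (2 * (101 / 100 : ℝ) ^ 2))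
    (hq : 1 - (101 / 100 : ℝ) ^ 2 / 2 ≤ q) (hq' : q ≤ 1 - 1 / (2 * (101 / 100 : ℝ) ^ 2))
    (hs0 : 0 ≤ s) (hs : s ^ 2 = 1 - p ^ 2) (ht0 : 0 ≤ t) (ht : t ^ 2 = 1 - q ^ 2)
    (hsepc : p * q + s * t * c ≤ 1 - 1 / (2 * (101 / 100 : ℝ) ^ 2)) :
    c ≤ 1100895889399 / 3100895889399 :=
  corner_cos_upper (ca := 1 - 1 / (2 * (101 / 100 : ℝ) ^ 2)) (cb := 1 - (101 / 100 : ℝ) ^ 2 / 2)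
    (by norm_num) (by norm_num) (by norm_num) (by norm_num) (by norm_num) hp hp' hq hq' hs0 hs ht0
    ht hsepc

end Summit.AtomisticToContinuum.Crystallization.Theorems
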